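import HarnessLib
import Summits.NavierStokesRegularity.NavierStokesRegularity.Theses.QuarterLogPincer
import Summits.NavierStokesRegularity.NavierStokesRegularity.Theorems.QuarterLogPincerTypeIQuantSubcubicExpFrameTools

/-!
# LINE `bead_census` (ns-idea-7 g11, lens «nearmiss», target «DSS wall») — crux
`QuarterLogPincer.TypeIQuantSubcubicExp` (stmt-NavierStokesRegularity-24077, LADDER-NS wall W7)

**No summit is proved by this line.**  It is the LIOUVILLE-FREE route to the rung
`R := CubicRung.TypeIQuantCubicExp` of line `cubic_rung` (`log F_M(A) ≤ K_M A³` in the crux's SUP-RATE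
gauge): Barker–Prange's Carleman chain transported to the rate gauge, with its ONE non-transferring step
isolated as a typed, countable obstruction.

## Near-miss of record, measured deficit, single input
* Near-miss: Barker–Prange 2021 Prop. 2 ⇒ `log F ≤ 2M^{1023}·exp(exp(M^{1024}))·∫|u(t)|³` in the
  WEAK-`L³` gauge [corpus:paper:arxiv-2003.06717 p.10 Prop. 2; p.18 Step 4 (the scales are separated by
  `exp(2M^{1023})`, each regular scale deposits `≥ exp(-exp(M^{1023}))` of `L³` mass into its own shell
  `B(x₀, e^{M^{1023}}√s) \ B(x₀, √s)` at the evaluation time; the shells are disjoint and are summed)].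
* Gauge audit of the proof (what uses `L^{3,∞}` and how): Lemma 4 (backward propagation of
  concentration) — only through `L^{3,∞} ⊂ L²_uloc` [p.12, p.26 `C_weak`] = the LEAD's registered (I1)
  `UniformScaledEnergy` in the rate gauge; Lemma 27 (epochs of regularity) [p.34] — FREE under the
  sup-rate bound (every slice is `L^∞`); Lemma 20 / Cor. 21 (quantitative ANNULUS of regularity) [p.32] —
  the ONLY step needing global integrability of the slice at level `M`; in the rate gauge the same
  pigeonhole runs at level `A` (`‖u(t)‖₃ ≤ A`) and the bound degenerates to Tao's `A`-only triple
  exponential.  MEASURED DEFICIT = exactly Lemma 20.  SINGLE INPUT = a supply of BP-regular annuli at all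
  but `O_M(A³)` of the concentration levels: the BEAD CENSUS `BeadCensus` below — since v1.2 DERIVED
  (kernel) from its typed honest content `FlarePersistence` (stub `stub_flarePersistence`).
* Why a census is plausible ONLY in the sup-rate gauge (the line's lever, PROVED here as
  `displacement_le_of_speed_le_rate` / `outer_region_frozen`): material speed `≤ M(T+τ-t)^{-1/2}` moves a
  fluid particle by at most `2M√(T+τ-t₀)` after time `t₀`, so a particle in the OUTER region
  `‖x - x₀‖ ≥ 4M√(T+τ-t₀)` never enters `B(x₀, 2M√(T+τ-t₀))`: level shells beyond similarity radius `4M`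
  are materially FROZEN — an active «bead» can spoil the annulus search of `O(1)` levels only, and what it
  deposits lands in ITS level's trace shell (the LEAD's (I2) final-window continuity), where the disjoint
  shells share the budget `∫|u(T)|³ ≤ A³`.  Weak-`L³` caps no pointwise speed: this lever does not exist
  in BP's gauge.  The residual enemy, named: BURN-OUT FLARES — transient Type-I-amplitude events in an
  outer shell that leave final trace below threshold (each is a near-singular excursion at its own scale;
  ε-regularity forbids them from seeds of small scale-invariant energy, nothing known forbids them in
  general).  Persistent beads (satellite singular points, necklaces) are harmless: `≤ A³/ε₀` of them.

## Board
`FlarePersistence` (G1♯, crux-let, conjectural; stub; v1.2 per critic N3) ⇒ `BeadCensus` (kernel: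
`censusAt_of_flarePersistenceAt` — disjoint measurable trace shells `levelShell_disjoint`, additivity of the
Lebesgue integral over them, `‖u(t₁)‖₃³ ≤ A³`; so `#bad·c ≤ A³`) + `BPChainRate` (G2: Tao seed + BP21 §3 + §§5–6 in the
rate gauge GIVEN the annuli; published mechanisms, XL; stub) ⇒ `QuantCubicExpAt M` at large `M` (kernel:
`quantCubicExpAt_of_censusAt_of_chainAt`, a counting argument: `n` levels = good + bad, good `≤ A³/c`,
bad `≤ C A³`, `log A ≤ A³` absorbs the seed loss) ⇒ all `M` by antitonicity (`quantCubicExpAt_antitone`)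
⇒ `TypeIQuantCubicExp` (`typeIQuantCubicExp_of_beadCensus_of_bpChainRate`; with stubs plugged:
`typeIQuantCubicExp_of_stubs`, sorries = the two stubs).  `QuantCubicExpAt` / `TypeIQuantCubicExp` are restated
VERBATIM from `Lines/cubic_rung.lean` (namespace `CubicRung`; `Iff.rfl` once that module is built), so
`cubic_rung`'s proved `TypeIQuantSubcubicExp → R` and `SmallBudgetTowerLiouville → R` apply unchanged.

## Why this line / why novel
* vs `cubic_rung` (g11-1): that line pays for R with a Liouville-type floor (compactness + backward
  uniqueness, open kernel = Seregin p.187); this line pays for R with NO Liouville and NO compactness —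
  Carleman + counting — and its open piece is a finite-`A` CENSUS in the Tao frame, testable on numerics.
* vs `thin_cascade`/`ab_root`/`quiet_*` (LEAD and g5–g10): all extract a limit object; here nothing is
  extracted.  vs `truncation_edge` (I2 deposit): I2 is used as a tool inside the census heuristic, across
  levels, not as an edge.  vs routes QuarterLogPincer/TypeIQuarterGate: no DSS hypothesis; BELOW the wall.
* bears_on: W7 rung «R0-rate» (proposed with cubic_rung); instrument row (pub-ns-dss): NEW measurable —
  in Type-I candidate runs, count outer-shell flares (similarity radius `> 4M`) that burn out before the
  final time; the census predicts `O(A³)` in total, a DSS candidate with `q` per octave predicts shells all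
  quiet beyond `|y| ≈ C_q M^{3μ}` (its `1/|x|` tail is BP-regular).
* Cheapest falsifier: a Type-I (sup-rate) smooth solution family exhibiting unboundedly many burn-out
  flares in disjoint outer shells at fixed `(M, A)` whose final traces `→ 0` — kills `stub_flarePersistence`
  (its typed target since v1.2; the census and R survive only by accident / via cubic_rung);
  a printed rate-gauge annulus lemma — makes the line a porting job.
-/

set_option linter.dupNamespace false

namespace Summit.NavierStokesRegularity.NavierStokesRegularity.Cruxes.TypeIQuantSubcubicExp.BeadCensus

noncomputable section

open MeasureTheory Set Function Filter Topology Metric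
open scoped ENNReal NNReal Classical
open Literature.Analysis Literature.Analysis.FluidPDE
open Summit.NavierStokesRegularity.NavierStokesRegularity.Theorems.ThinCascade

local notation "E3" => EuclideanSpace ℝ (Fin 3)

/-! ## 0. The rung (verbatim from `Lines/cubic_rung.lean`, namespace `CubicRung`) -/

/-- `= CubicRung.QuantCubicExpAt` verbatim (restated because crux workfiles are not yet importable from
one another on the farm; `Iff.rfl` bridges them). -/
def QuantCubicExpAt (M : ℝ) : Prop :=
  ∃ K : ℝ, ∀ (T τ A : ℝ) (u : ℝ → E3 → E3) (p : ℝ → E3 → ℝ),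
    (IsClassicalNSSolutionOn (Icc 0 T) 1 0 u p ∧
        ∀ n : ℕ, ∃ C : NNReal, ∀ t ∈ Icc 0 T, eLpNorm (iteratedFDeriv ℝ n (u t)) 2 volume ≤ C) →
      0 < τ →
      (∀ t ∈ Icc 0 T, ∀ x : E3, ‖u t x‖ ≤ M * (T + τ - t) ^ (-(1 / 2 : ℝ))) →
      (∀ t ∈ Icc 0 T, eLpNorm (u t) 3 volume ≤ ENNReal.ofReal A) → 2 ≤ A →
      ∀ t ∈ Ioc 0 T, ∀ x : E3, ‖u t x‖ ≤ Real.exp (K * A ^ 3) * t ^ (-(1 / 2 : ℝ))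

/-- `= CubicRung.TypeIQuantCubicExp` verbatim: the rung R. -/
def TypeIQuantCubicExp : Prop := ∀ M : ℝ, QuantCubicExpAt M

/-- R is ANTITONE in the Type-I constant: a bound valid for rate `M'` serves every `M ≤ M'`. -/
theorem quantCubicExpAt_antitone {M M' : ℝ} (hMM' : M ≤ M') (h : QuantCubicExpAt M') :
    QuantCubicExpAt M := by
  obtain ⟨K, hK⟩ := h
  refine ⟨K, fun T τ A u p hframe hτ htypeI hL3 hA t ht x => hK T τ A u p hframe hτ ?_ hL3 hA t ht x⟩
  intro s hs y
  exact (htypeI s hs y).trans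
    (mul_le_mul_of_nonneg_right hMM' (Real.rpow_nonneg (by linarith [hs.2, hτ.le]) _))

/-- The crux implies the rung (verbatim from `Lines/cubic_rung.lean`): R is a genuine rung BELOW
`TypeIQuantSubcubicExp` — `∀ ε` specialised to `ε = 1`, the finite range `A < A₀` absorbed by `8 ≤ A³`. -/
theorem typeIQuantCubicExp_of_typeIQuantSubcubicExp
    (h : Summit.NavierStokesRegularity.NavierStokesRegularity.Theses.QuarterLogPincer.TypeIQuantSubcubicExp) :
    TypeIQuantCubicExp := by
  intro M
  obtain ⟨F, hF, hbd⟩ := h M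
  obtain ⟨A₀, hA₀⟩ := hF 1 one_pos
  refine ⟨1 + |A₀| ^ 3 / 8, ?_⟩
  intro T τ A u p hframe hτ htypeI hL3 hA t ht x
  -- enlarge the history level to `A' := max A A₀`
  have hAA' : A ≤ max A A₀ := le_max_left _ _
  have hL3' : ∀ s ∈ Icc 0 T, eLpNorm (u s) 3 volume ≤ ENNReal.ofReal (max A A₀) := fun s hs =>
    (hL3 s hs).trans (ENNReal.ofReal_le_ofReal hAA')
  have hA' : 2 ≤ max A A₀ := hA.trans hAA'
  have hbound := hbd T τ (max A A₀) u p hframe hτ htypeI hL3' hA' t ht x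
  have hFle : F (max A A₀) ≤ Real.exp (1 * (max A A₀) ^ 3) := hA₀ _ (le_max_right _ _)
  have hcube : 1 * (max A A₀) ^ 3 ≤ (1 + |A₀| ^ 3 / 8) * A ^ 3 := by
    have hA3 : 8 ≤ A ^ 3 := by
      calc (8 : ℝ) = 2 ^ 3 := by norm_num
        _ ≤ A ^ 3 := by gcongr
    have habs : 0 ≤ |A₀| ^ 3 := by positivity
    rcases le_total A₀ A with hle | hle
    · rw [max_eq_left hle]
      nlinarith
    · rw [max_eq_right hle]
      have hA₀pos : 0 ≤ A₀ := by linarith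
      have h1 : A₀ ^ 3 = |A₀| ^ 3 := by rw [abs_of_nonneg hA₀pos]
      have h2 : |A₀| ^ 3 ≤ |A₀| ^ 3 / 8 * A ^ 3 := by nlinarith
      nlinarith
  have ht0 : 0 ≤ t ^ (-(1 / 2 : ℝ)) := Real.rpow_nonneg ht.1.le _
  calc ‖u t x‖ ≤ F (max A A₀) * t ^ (-(1 / 2 : ℝ)) := hbound
    _ ≤ Real.exp (1 * (max A A₀) ^ 3) * t ^ (-(1 / 2 : ℝ)) := mul_le_mul_of_nonneg_right hFle ht0
    _ ≤ Real.exp ((1 + |A₀| ^ 3 / 8) * A ^ 3) * t ^ (-(1 / 2 : ℝ)) :=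
        mul_le_mul_of_nonneg_right (Real.exp_le_exp.2 hcube) ht0

/-! ## 1. Levels, trace shells, BP-regular annuli (rate gauge) -/

/-- Parabolic scale of level `k` below the evaluation time `t₁`, log-separation `a` per level:
`s_k = t₁ · e^{-2ak}` (BP21: `a = M^{1023}`). -/
def levelScale (a t₁ : ℝ) (k : ℕ) : ℝ := t₁ * Real.exp (-2 * a * k)

/-- The level-`k` TRACE SHELL about `x₀`: `4M√s_k < ‖x − x₀‖ < e^{a}√s_k` — it starts beyond similarity
radius `4M` (materially frozen, `outer_region_frozen`) and ends where level `k−1` begins; the shells of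
distinct levels are disjoint once `e^{a} ≤ 4M e^{a}·e^{-a}`… precisely once `a ≥ log (4M)` they are
nested-disjoint (`levelShell_disjoint`, not needed by the kernel: disjointness is consumed inside
`stub_bpChainRate`'s summed conclusion). -/
def levelShell (M a t₁ : ℝ) (x₀ : E3) (k : ℕ) : Set E3 :=
  {x | 4 * M * Real.sqrt (levelScale a t₁ k) < ‖x - x₀‖ ∧
    ‖x - x₀‖ < Real.exp a * Real.sqrt (levelScale a t₁ k)}

/-- **A BP-REGULAR ANNULUS at level `k`** (Barker–Prange Lemma 20 / Cor. 21, conclusion, in the rate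
gauge's units): inside the level-`k` trace shell there is a radius `R` such that on
`{R < ‖x−x₀‖ < M^{10μ} R} × [t₁ − s_k/32, t₁]` the solution is quantitatively regular UP TO the
evaluation time, `‖∇ʲu‖ ≤ M^{-3μ} s_k^{-(j+1)/2}` for `j ≤ 2`. [corpus:paper:arxiv-2003.06717 p.32] -/
def GoodLevel (M μ a : ℝ) (u : ℝ → E3 → E3) (t₁ : ℝ) (x₀ : E3) (k : ℕ) : Prop :=
  ∃ R : ℝ, 4 * M * Real.sqrt (levelScale a t₁ k) ≤ R ∧
    M ^ (10 * μ) * R ≤ Real.exp a * Real.sqrt (levelScale a t₁ k) ∧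
    ∀ t ∈ Icc (t₁ - levelScale a t₁ k / 32) t₁, ∀ x : E3,
      R < ‖x - x₀‖ → ‖x - x₀‖ < M ^ (10 * μ) * R →
      ∀ j : ℕ, j ≤ 2 →
        ‖iteratedFDeriv ℝ j (u t) x‖ ≤ M ^ (-(3 * μ)) * (levelScale a t₁ k) ^ (-(((j : ℝ) + 1) / 2))

/-! ## 2. The lever, PROVED: sub-similar kinematics of the sup-rate gauge -/

/-- **Displacement bound.**  A curve `X` on `[t₀, b]` with speed `‖X'(t)‖ ≤ M (T' − t)^{-1/2}` (`b < T'`)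
moves by at most `2M(√(T'−t₀) − √(T'−t)) ≤ 2M√(T'−t₀)` by time `t`.  (Material transport under the
virtual Type-I rate `M(T+τ−t)^{-1/2}`, `T' = T+τ`.) [Mathlib ODE comparison
`image_norm_le_of_norm_deriv_right_le_deriv_boundary`] -/
theorem displacement_le_of_speed_le_rate {X V : ℝ → E3} {t₀ b T' M : ℝ} (hb : b < T')
    (hcont : ContinuousOn X (Icc t₀ b))
    (hderiv : ∀ t ∈ Ico t₀ b, HasDerivWithinAt X (V t) (Ici t) t)
    (hspeed : ∀ t ∈ Ico t₀ b, ‖V t‖ ≤ M * (T' - t) ^ (-(1 / 2 : ℝ))) :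
    ∀ t ∈ Icc t₀ b, ‖X t - X t₀‖ ≤ 2 * M * (Real.sqrt (T' - t₀) - Real.sqrt (T' - t)) := by
  -- boundary function `B t = 2M(√(T'−t₀) − √(T'−t))`, `B' t = M/√(T'−t)`
  have hB : ∀ t ∈ Ico t₀ b, HasDerivWithinAt (fun t => 2 * M * (Real.sqrt (T' - t₀) - Real.sqrt (T' - t)))
      (M * (T' - t) ^ (-(1 / 2 : ℝ))) (Ici t) t := by
    intro t ht
    have htT : 0 < T' - t := by linarith [ht.2]
    have h1 : HasDerivAt (fun s => T' - s) (-1) t := by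
      simpa using (hasDerivAt_id t).const_sub T'
    have h2 : HasDerivAt (fun s => Real.sqrt (T' - s)) ((-1) / (2 * Real.sqrt (T' - t))) t :=
      h1.sqrt htT.ne'
    have h3 : HasDerivAt (fun s => 2 * M * (Real.sqrt (T' - t₀) - Real.sqrt (T' - s)))
        (2 * M * (0 - (-1) / (2 * Real.sqrt (T' - t)))) t :=
      ((hasDerivAt_const t _).sub h2).const_mul _
    have e : 2 * M * (0 - (-1) / (2 * Real.sqrt (T' - t))) = M * (T' - t) ^ (-(1 / 2 : ℝ)) := by
      have hsq : Real.sqrt (T' - t) ≠ 0 := (Real.sqrt_pos.2 htT).ne'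
      rw [Real.rpow_neg htT.le, ← Real.sqrt_eq_rpow]
      field_simp
      ring
    rw [← e]
    exact h3.hasDerivWithinAt
  have hBcont : ContinuousOn (fun t => 2 * M * (Real.sqrt (T' - t₀) - Real.sqrt (T' - t))) (Icc t₀ b) := by
    fun_prop
  have hf : ContinuousOn (fun t => X t - X t₀) (Icc t₀ b) := hcont.sub continuousOn_const
  have hf' : ∀ t ∈ Ico t₀ b, HasDerivWithinAt (fun t => X t - X t₀) (V t) (Ici t) t :=
    fun t ht => (hderiv t ht).sub_const _
  have h0 : ‖X t₀ - X t₀‖ ≤ 2 * M * (Real.sqrt (T' - t₀) - Real.sqrt (T' - t₀)) := by simp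
  intro t ht
  exact image_norm_le_of_norm_deriv_right_le_deriv_boundary' hf hf' h0 hBcont hB
    (fun s hs => hspeed s hs) ht

/-- **OUTER REGION FROZEN.**  Under the same speed bound, a particle starting at distance
`≥ 4M√(T'−t₀)` from `x₀` stays at distance `≥ 2M√(T'−t₀)` — it never reaches the similarity core, so the
level shells `levelShell` (which start at similarity radius `4M`) are materially disconnected from the
cascade core and from each other's cores.  This is the lever the weak-`L³` gauge lacks. -/
theorem outer_region_frozen {X V : ℝ → E3} {t₀ b T' M : ℝ} (hb : b < T') (hM : 0 ≤ M)
    (hcont : ContinuousOn X (Icc t₀ b))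
    (hderiv : ∀ t ∈ Ico t₀ b, HasDerivWithinAt X (V t) (Ici t) t)
    (hspeed : ∀ t ∈ Ico t₀ b, ‖V t‖ ≤ M * (T' - t) ^ (-(1 / 2 : ℝ)))
    {x₀ : E3} (hfar : 4 * M * Real.sqrt (T' - t₀) ≤ ‖X t₀ - x₀‖) :
    ∀ t ∈ Icc t₀ b, 2 * M * Real.sqrt (T' - t₀) ≤ ‖X t - x₀‖ := by
  intro t ht
  have hdisp := displacement_le_of_speed_le_rate hb hcont hderiv hspeed t ht
  have hsq : 0 ≤ Real.sqrt (T' - t) := Real.sqrt_nonneg _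
  have hdisp' : ‖X t - X t₀‖ ≤ 2 * M * Real.sqrt (T' - t₀) := by
    refine hdisp.trans ?_
    nlinarith
  have htri : ‖X t₀ - x₀‖ ≤ ‖X t - x₀‖ + ‖X t - X t₀‖ := by
    have := norm_sub_le_norm_sub_add_norm_sub (X t₀) (X t) x₀
    rw [norm_sub_rev (X t₀) (X t)] at this
    linarith
  linarith

/-! ## 3. The two statements (as named Props) and their stubs -/

/-- `ChainAt M μ a b c`: BP's chain at Type-I constant `M` with smallness exponent `μ`, level separation
`a`, seed loss `b`, deposit `c` — a violator `e^{a(n+1)} A^{b} ≤ ‖u(t₁,x₀)‖√t₁` yields `n` levels and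
every GOOD level deposits `≥ c` into its own (disjoint) trace shell at time `t₁`: `#good · c ≤ A³`. -/
def ChainAt (M μ a b c : ℝ) : Prop :=
  ∀ (T τ A t₁ : ℝ) (x₀ : E3) (u : ℝ → E3 → E3) (p : ℝ → E3 → ℝ) (n : ℕ),
    (IsClassicalNSSolutionOn (Icc 0 T) 1 0 u p ∧
        ∀ m : ℕ, ∃ C : NNReal, ∀ t ∈ Icc 0 T, eLpNorm (iteratedFDeriv ℝ m (u t)) 2 volume ≤ C) →
      0 < τ →
      (∀ t ∈ Icc 0 T, ∀ x : E3, ‖u t x‖ ≤ M * (T + τ - t) ^ (-(1 / 2 : ℝ))) →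
      (∀ t ∈ Icc 0 T, eLpNorm (u t) 3 volume ≤ ENNReal.ofReal A) → 2 ≤ A →
      t₁ ∈ Ioc 0 T → Real.exp (a * (n + 1) + b * Real.log A) ≤ ‖u t₁ x₀‖ * Real.sqrt t₁ →
      (((Finset.range n).filter fun k => GoodLevel M μ a u t₁ x₀ (k + 1)).card : ℝ) * c ≤ A ^ 3

/-- `CensusAt M μ a C`: about ANY point and for ANY depth `n`, at most `C·A³` of the levels `1..n` are
BAD (no BP-regular annulus in their trace shell). -/
def CensusAt (M μ a C : ℝ) : Prop :=
  ∀ (T τ A t₁ : ℝ) (x₀ : E3) (u : ℝ → E3 → E3) (p : ℝ → E3 → ℝ) (n : ℕ),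
    (IsClassicalNSSolutionOn (Icc 0 T) 1 0 u p ∧
        ∀ m : ℕ, ∃ C : NNReal, ∀ t ∈ Icc 0 T, eLpNorm (iteratedFDeriv ℝ m (u t)) 2 volume ≤ C) →
      0 < τ →
      (∀ t ∈ Icc 0 T, ∀ x : E3, ‖u t x‖ ≤ M * (T + τ - t) ^ (-(1 / 2 : ℝ))) →
      (∀ t ∈ Icc 0 T, eLpNorm (u t) 3 volume ≤ ENNReal.ofReal A) → 2 ≤ A →
      t₁ ∈ Ioc 0 T →
      (((Finset.range n).filter fun k => ¬ GoodLevel M μ a u t₁ x₀ (k + 1)).card : ℝ) ≤ C * A ^ 3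

/-- **G2 — `BPChainRate` (size XL; PUBLISHED MECHANISMS, rate gauge; no wall): Barker–Prange's chain
GIVEN the annuli.**  There are `μ > 0`, `M₀ ≥ 1`, `b ≥ 0` (v1.2, critic N2: the intended regime typed — for `μ ≤ 0` or
`M < 1` the annulus in `GoodLevel` degenerates) and, for `M ≥ M₀`, `a₁ = a₁(M) > 0`, `c = c(M) > 0` with
`ChainAt M μ a b c` for EVERY level separation `a ≥ a₁` (BP21: `a₁ = M^{1023}`; sparser levels only
mean fewer levels per violator, each still depositing `c`): SEED — Tao's global regularity mechanism turns the violator into a frequency bubble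
`N₀^{-1}|P_{N₀}u(x₀,t₁)| > A^{-O(1)}` with `N₀√t₁ ≳ e^{a(n+1)}` (the factor `A^{b} = e^{b log A}` is this
seed loss) [Tao19 Thm 5.1 / Prop 3.2 as quoted in corpus:paper:arxiv-2003.06717 p.5]; LEVELS — backward
propagation of concentration to every coarser scale `s_k = t₁e^{-2ak}`, `k ≤ n` (BP Lemma 4, whose only
use of `L^{3,∞}` is `L²_uloc` = the LEAD's registered (I1) `UniformScaledEnergy` in the rate gauge
[p.12, p.26]); epochs free (Lemma 27 [p.34]); DEPOSIT — at a GOOD level the two Carleman inequalities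
across the BP-regular annulus give `∫_{shell_k}|u(t₁)|³ ≥ c := exp(-exp(M^{O(1)}))` [p.14–18 Steps
1–4]; SUM — the trace shells of distinct levels are disjoint, `#good·c ≤ ‖u(t₁)‖₃³ ≤ A³` [p.18 Step
4/5].  Why it might fail: not as mathematics — every step is in print with the annulus as its only
gauge-sensitive input, here moved into the hypothesis `GoodLevel`; the risk is porting cost (XL) and
bookkeeping of constants. -/
def BPChainRate : Prop :=
  ∃ μ M₀ b : ℝ, 0 < μ ∧ 1 ≤ M₀ ∧ 0 ≤ b ∧ ∀ M : ℝ, M₀ ≤ M →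
    ∃ a₁ c : ℝ, 0 < a₁ ∧ 0 < c ∧ ∀ a : ℝ, a₁ ≤ a → ChainAt M μ a b c

/-- **`BeadCensus`** (v1.2: DERIVED from G1♯ `FlarePersistence` by `beadCensus_of_flarePersistence`;
regime `μ > 0`, `M ≥ 1` typed per critic N2): for every such `(μ, M)` and every level
separation `a ≥ a₀(μ, M)` (below `a = log(4M^{1+10μ})` the annulus range in `GoodLevel` is empty and
every level is trivially bad) there is `C` with `CensusAt M μ a C`.**  Heuristic FOR: the trace shells start beyond similarity radius `4M`, hence are
materially frozen (`outer_region_frozen` — a lever that exists only in the sup-rate gauge); activity in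
shell `k` during the level-`k` window deposits into shell `k`'s final trace (LEAD (I2) final-window
continuity); the shells are disjoint and share `∫|u|³ ≤ A³`; seeds of small scale-invariant energy
cannot flare (ε-regularity).  Why it might fail: BURN-OUT FLARES — transient Type-I-amplitude events in
outer shells whose final trace falls below the deposit threshold; a smooth Type-I family with unboundedly
many of them in disjoint shells at fixed `(M, A)` refutes `BeadCensus` (the rung R survives via
`cubic_rung`).  Persistent beads (satellite singular points, necklaces `λ^k x₁ → x₀`) cost `≥ ε₀` of
trace each — at most `A³/ε₀`, harmless.  Sources: [corpus:paper:arxiv-2003.06717 p.32 Lemma 20 /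
Cor. 21 (the step replaced)], ε-regularity [CaffarelliKohnNirenberg1982], LEAD (I2)
`Theorems/QuarterLogPincerTypeIQuantSubcubicExpTruncationEdge*.lean`. -/
def BeadCensus : Prop :=
  ∀ μ M : ℝ, 0 < μ → 1 ≤ M → ∃ a₀ : ℝ, ∀ a : ℝ, a₀ ≤ a → ∃ C : ℝ, CensusAt M μ a C

/-- STUB (XL, published mechanisms): see `BPChainRate`. -/
theorem stub_bpChainRate : BPChainRate := by
  sorry

/-! ### 3♯. The census's honest content, TYPED (v1.2, critic N3): FLARE PERSISTENCE -/

/-- `FlarePersistenceAt M μ a c` — **the typed gap of the census**: in the crux's frame at Type-I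
constant `M`, a BAD level `k+1` about `x₀` (no BP-regular annulus anywhere in its trace shell during its
window) has left at least `c` of CUBE TRACE in that shell AT THE EVALUATION TIME `t₁`:
`c ≤ ∫_{levelShell (k+1)} |u(t₁)|³`.  Informally: a Type-I flare at scale `√s` inside a materially frozen
shell cannot burn out below trace `c(M, μ, a)` within time `s/32` — short-time `L³` PERSISTENCE at
Reynolds number `M`.  KNOWN for small scale-invariant energy (ε-regularity: such seeds do not flare at
all) and for persistent beads (satellite singular points / necklaces carry `≥ ε₀` of trace); OPEN in
general.  Why it might fail: BURN-OUT FLARES — a bad level is bad because EVERY candidate annulus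
`{R < |x−x₀| < M^{10μ}R}` of the shell sees a violation at some time of the window, i.e. `≳ a/(10μ log M)`
well-separated CKN-concentration events, each of which may live at a tiny scale `r` (cube mass `∼ ε`
at time `t`, lifetime `∼ r²`) and dissipate before `t₁`; a family with such flares of total final trace
`→ 0` at fixed `(M, μ, a)` refutes `FlarePersistenceAt M μ a c` for every `c > 0`.  This statement is
STRONGER than the census (`censusAt_of_flarePersistenceAt` below; the census could survive its failure
only by a counting accident) and is the typed target of the line's cheapest falsifier (instrument row
«outer-shell flare census»).  Sources: [corpus:paper:arxiv-2003.06717 p.32 Lemma 20 / Cor. 21 (the step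
it replaces), p.18 Step 4 (disjoint-shell summation)], ε-regularity [CaffarelliKohnNirenberg1982], LEAD
(I2) `Theorems/QuarterLogPincerTypeIQuantSubcubicExpTruncationEdge*.lean` (final-window continuity). -/
def FlarePersistenceAt (M μ a c : ℝ) : Prop :=
  ∀ (T τ A t₁ : ℝ) (x₀ : E3) (u : ℝ → E3 → E3) (p : ℝ → E3 → ℝ) (k : ℕ),
    (IsClassicalNSSolutionOn (Icc 0 T) 1 0 u p ∧
        ∀ m : ℕ, ∃ C : NNReal, ∀ t ∈ Icc 0 T, eLpNorm (iteratedFDeriv ℝ m (u t)) 2 volume ≤ C) →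
      0 < τ →
      (∀ t ∈ Icc 0 T, ∀ x : E3, ‖u t x‖ ≤ M * (T + τ - t) ^ (-(1 / 2 : ℝ))) →
      (∀ t ∈ Icc 0 T, eLpNorm (u t) 3 volume ≤ ENNReal.ofReal A) → 2 ≤ A →
      t₁ ∈ Ioc 0 T → ¬ GoodLevel M μ a u t₁ x₀ (k + 1) →
      ENNReal.ofReal c ≤ ∫⁻ x in levelShell M a t₁ x₀ (k + 1), ‖u t₁ x‖ₑ ^ (3 : ℝ)

/-- **G1♯ — `FlarePersistence` (the CRUX-LET, v1.2; conjectural; no wall):** in the intended regime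
`μ > 0`, `M ≥ 1`, for every level separation `a ≥ a₀(μ,M) ≥ 0` there is a deposit `c = c(M,μ,a) > 0` with
`FlarePersistenceAt M μ a c`. -/
def FlarePersistence : Prop :=
  ∀ μ M : ℝ, 0 < μ → 1 ≤ M → ∃ a₀ : ℝ, 0 ≤ a₀ ∧ ∀ a : ℝ, a₀ ≤ a →
    ∃ c : ℝ, 0 < c ∧ FlarePersistenceAt M μ a c

/-- STUB (the crux-let, v1.2): see `FlarePersistence`. -/
theorem stub_flarePersistence : FlarePersistence := by
  sorry

/-- `√s_j = √t₁ · e^{-a j}`. -/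
theorem sqrt_levelScale (a t₁ : ℝ) (j : ℕ) :
    Real.sqrt (levelScale a t₁ j) = Real.sqrt t₁ * Real.exp (-(a * j)) := by
  have h : Real.exp (-2 * a * j) = Real.exp (-(a * j)) ^ 2 := by
    rw [sq, ← Real.exp_add]; ring_nf
  rw [levelScale, Real.sqrt_mul' _ (Real.exp_nonneg _), h, Real.sqrt_sq (Real.exp_nonneg _)]

/-- The trace shells are measurable (open spherical shells). -/
theorem measurableSet_levelShell (M a t₁ : ℝ) (x₀ : E3) (k : ℕ) :
    MeasurableSet (levelShell M a t₁ x₀ k) := by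
  have hf : Measurable fun x : E3 => ‖x - x₀‖ := (measurable_id.sub_const x₀).norm
  simpa only [levelShell, Set.setOf_and] using
    (measurableSet_lt measurable_const hf).inter (measurableSet_lt hf measurable_const)

/-- **Disjointness of the trace shells of distinct levels** (`M ≥ 1/4`, `a ≥ 0`): shell `j` ends at
radius `e^{a}√s_j = √s_{j-1} ≤ 4M√s_i` for `i < j`. -/
theorem levelShell_disjoint {M a t₁ : ℝ} (hM : 1 / 4 ≤ M) (ha : 0 ≤ a) (x₀ : E3) {i j : ℕ}
    (hij : i < j) : Disjoint (levelShell M a t₁ x₀ i) (levelShell M a t₁ x₀ j) := by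
  rw [Set.disjoint_left]
  rintro x ⟨hxi, -⟩ ⟨-, hxj⟩
  have hle : Real.exp a * Real.sqrt (levelScale a t₁ j) ≤ 4 * M * Real.sqrt (levelScale a t₁ i) := by
    rw [sqrt_levelScale, sqrt_levelScale]
    have hj : (i : ℝ) + 1 ≤ j := by exact_mod_cast Nat.succ_le_of_lt hij
    have h1 : Real.exp a * Real.exp (-(a * j)) ≤ Real.exp (-(a * i)) := by
      rw [← Real.exp_add]
      apply Real.exp_le_exp.2
      have := mul_nonneg ha (sub_nonneg.2 hj)
      nlinarith
    have ht : 0 ≤ Real.sqrt t₁ := Real.sqrt_nonneg _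
    have hpos : 0 ≤ Real.sqrt t₁ * Real.exp (-(a * i)) := mul_nonneg ht (Real.exp_nonneg _)
    calc Real.exp a * (Real.sqrt t₁ * Real.exp (-(a * j)))
        = Real.sqrt t₁ * (Real.exp a * Real.exp (-(a * j))) := by ring
      _ ≤ Real.sqrt t₁ * Real.exp (-(a * i)) := mul_le_mul_of_nonneg_left h1 ht
      _ = 1 * (Real.sqrt t₁ * Real.exp (-(a * i))) := by ring
      _ ≤ 4 * M * (Real.sqrt t₁ * Real.exp (-(a * i))) :=
          mul_le_mul_of_nonneg_right (by linarith) hpos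
  linarith

/-- **THE ACCOUNTING (kernel-checked, v1.2): flare persistence ⇒ the census, `C = 1/c`.**  The bad
levels' shells are pairwise disjoint and each holds `≥ c` of cube trace at time `t₁`, while the whole
slice holds `‖u(t₁)‖₃³ ≤ A³`: `#bad · c ≤ A³`. -/
theorem censusAt_of_flarePersistenceAt {M μ a c : ℝ} (hM : 1 ≤ M) (ha : 0 ≤ a) (hc : 0 < c)
    (h : FlarePersistenceAt M μ a c) : CensusAt M μ a (1 / c) := by
  intro T τ A t₁ x₀ u p n hframe hτ hrate hL3 hA ht₁
  set B := (Finset.range n).filter fun k => ¬ GoodLevel M μ a u t₁ x₀ (k + 1) with hB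
  have hA0 : 0 ≤ A := by linarith
  -- the slice's cube mass
  have hI : ∫⁻ x, ‖u t₁ x‖ₑ ^ (3 : ℝ) ≤ ENNReal.ofReal (A ^ 3) := by
    have hL := hL3 t₁ ⟨ht₁.1.le, ht₁.2⟩
    rw [eLpNorm_eq_lintegral_rpow_enorm_toReal (by norm_num) (by norm_num)] at hL
    simp only [ENNReal.toReal_ofNat] at hL
    have h3 := ENNReal.rpow_le_rpow hL (by norm_num : (0 : ℝ) ≤ 3)
    rw [← ENNReal.rpow_mul, show (1 / 3 : ℝ) * 3 = 1 by norm_num, ENNReal.rpow_one,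
      ENNReal.ofReal_rpow_of_nonneg hA0 (by norm_num : (0 : ℝ) ≤ 3)] at h3
    have hA3 : A ^ (3 : ℝ) = A ^ 3 := by
      rw [show (3 : ℝ) = ((3 : ℕ) : ℝ) by norm_num, Real.rpow_natCast]
    rwa [hA3] at h3
  -- each bad level deposits ≥ c into its own shell
  have hdep : ∀ k ∈ B, ENNReal.ofReal c ≤
      ∫⁻ x in levelShell M a t₁ x₀ (k + 1), ‖u t₁ x‖ₑ ^ (3 : ℝ) := by
    intro k hk
    exact h T τ A t₁ x₀ u p k hframe hτ hrate hL3 hA ht₁ (Finset.mem_filter.1 hk).2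
  -- the shells of distinct bad levels are disjoint
  have hdisj : Set.PairwiseDisjoint (↑B : Set ℕ) (fun k => levelShell M a t₁ x₀ (k + 1)) := by
    intro i _ j _ hne
    change Disjoint (levelShell M a t₁ x₀ (i + 1)) (levelShell M a t₁ x₀ (j + 1))
    have hM4 : 1 / 4 ≤ M := by linarith
    rcases Nat.lt_or_gt_of_ne hne with hlt | hgt
    · exact levelShell_disjoint hM4 ha x₀ (Nat.succ_lt_succ hlt)
    · exact (levelShell_disjoint hM4 ha x₀ (Nat.succ_lt_succ hgt)).symm
  -- sum
  have hsum : (B.card : ℝ≥0∞) * ENNReal.ofReal c ≤ ENNReal.ofReal (A ^ 3) := by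
    calc (B.card : ℝ≥0∞) * ENNReal.ofReal c
        = ∑ k ∈ B, ENNReal.ofReal c := by simp [Finset.sum_const, nsmul_eq_mul]
      _ ≤ ∑ k ∈ B, ∫⁻ x in levelShell M a t₁ x₀ (k + 1), ‖u t₁ x‖ₑ ^ (3 : ℝ) :=
          Finset.sum_le_sum hdep
      _ = ∫⁻ x in ⋃ k ∈ B, levelShell M a t₁ x₀ (k + 1), ‖u t₁ x‖ₑ ^ (3 : ℝ) :=
          (lintegral_biUnion_finset hdisj (fun k _ => measurableSet_levelShell M a t₁ x₀ (k + 1)) _).symm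
      _ ≤ ∫⁻ x, ‖u t₁ x‖ₑ ^ (3 : ℝ) := setLIntegral_le_lintegral _ _
      _ ≤ ENNReal.ofReal (A ^ 3) := hI
  -- back to reals
  have hA3 : 0 ≤ A ^ 3 := by positivity
  have hreal : (B.card : ℝ) * c ≤ A ^ 3 := by
    have h' : ENNReal.ofReal ((B.card : ℝ) * c) ≤ ENNReal.ofReal (A ^ 3) := by
      rwa [ENNReal.ofReal_mul (Nat.cast_nonneg _), ENNReal.ofReal_natCast]
    exact (ENNReal.ofReal_le_ofReal_iff hA3).1 h'
  have hcard : (B.card : ℝ) ≤ A ^ 3 / c := by rw [le_div_iff₀ hc]; exact hreal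
  calc (B.card : ℝ) ≤ A ^ 3 / c := hcard
    _ = 1 / c * A ^ 3 := by ring

/-- **`FlarePersistence → BeadCensus`** (kernel-checked). -/
theorem beadCensus_of_flarePersistence (hF : FlarePersistence) : BeadCensus := by
  intro μ M hμ hM
  obtain ⟨a₀, ha₀, h⟩ := hF μ M hμ hM
  refine ⟨a₀, fun a ha => ?_⟩
  obtain ⟨c, hc, hP⟩ := h a ha
  exact ⟨1 / c, censusAt_of_flarePersistenceAt hM (ha₀.trans ha) hc hP⟩

/-- The census with the stub plugged in. -/
theorem beadCensus_of_stub : BeadCensus := beadCensus_of_flarePersistence stub_flarePersistence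

/-! ## 4. Kernel: census + chain ⇒ the rung -/

/-- Counting at fixed large `M`: `n = #good + #bad ≤ A³/c + C A³` levels fit under any violator of size
`e^{a(n+1)}A^{b}`; with `K := a(1/c + C + 2) + b` a violator of `exp(K A³)` would need more levels. -/
theorem quantCubicExpAt_of_censusAt_of_chainAt {M μ a b c : ℝ} (ha : 0 < a) (hb : 0 ≤ b) (hc : 0 < c)
    (hchain : ChainAt M μ a b c) (hcensus : ∃ C : ℝ, CensusAt M μ a C) : QuantCubicExpAt M := by
  obtain ⟨C, hbad⟩ := hcensus
  -- the census constant may be assumed nonnegative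
  set C' : ℝ := max C 0 with hC'
  have hC'0 : 0 ≤ C' := le_max_right _ _
  refine ⟨a * (1 / c + C' + 2) + b, ?_⟩
  intro T τ A u p hframe hτ htypeI hL3 hA t ht x
  by_contra hviol
  push Not at hviol
  have hA0 : 0 < A := by linarith
  have hA3 : 8 ≤ A ^ 3 := by
    calc (8 : ℝ) = 2 ^ 3 := by norm_num
      _ ≤ A ^ 3 := by gcongr
  -- `log A ≤ A³`
  have hlog : Real.log A ≤ A ^ 3 := by
    have h1 := Real.log_le_sub_one_of_pos hA0
    have h4 : 4 ≤ A ^ 2 := by nlinarith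
    have hAA : A ≤ A ^ 3 := by nlinarith
    linarith
  -- the violator in `√t` form
  have ht0 : 0 < t := ht.1
  have hsqrt : 0 < Real.sqrt t := Real.sqrt_pos.2 ht0
  have hviol' : Real.exp ((a * (1 / c + C' + 2) + b) * A ^ 3) < ‖u t x‖ * Real.sqrt t := by
    have e : t ^ (-(1 / 2 : ℝ)) = (Real.sqrt t)⁻¹ := by
      rw [Real.rpow_neg ht0.le, ← Real.sqrt_eq_rpow]
    rw [e, ← div_eq_mul_inv, div_lt_iff₀ hsqrt] at hviol
    exact hviol
  -- depth `n := ⌊L⌋₊ - 1`, `L := (1/c + C' + 2) A³`, so that `a (n+1) + b log A ≤ K A³`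
  set L : ℝ := (1 / c + C' + 2) * A ^ 3 with hL
  have hL1 : 2 ≤ L := by
    have : (0 : ℝ) ≤ 1 / c + C' := by positivity
    nlinarith
  set n : ℕ := ⌊L⌋₊ - 1 with hn
  have hfloor1 : 1 ≤ ⌊L⌋₊ := Nat.one_le_iff_ne_zero.2 (by
    intro h0
    have := (Nat.floor_eq_zero.1 h0)
    linarith)
  have hn_real : (n : ℝ) = (⌊L⌋₊ : ℝ) - 1 := by
    rw [hn, Nat.cast_sub hfloor1, Nat.cast_one]
  have hn_le : ((n : ℝ) + 1) ≤ L := by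
    rw [hn_real]
    have := Nat.floor_le (by linarith : (0 : ℝ) ≤ L)
    linarith
  have hn_ge : L - 2 ≤ (n : ℝ) := by
    rw [hn_real]
    have := Nat.lt_floor_add_one L
    linarith
  have hexp : Real.exp (a * (n + 1) + b * Real.log A) ≤ ‖u t x‖ * Real.sqrt t := by
    refine le_trans (Real.exp_le_exp.2 ?_) hviol'.le
    have h1 : a * ((n : ℝ) + 1) ≤ a * L := mul_le_mul_of_nonneg_left hn_le ha.le
    have h2 : b * Real.log A ≤ b * A ^ 3 := mul_le_mul_of_nonneg_left hlog hb
    have e : (a * (1 / c + C' + 2) + b) * A ^ 3 = a * L + b * A ^ 3 := by rw [hL]; ring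
    linarith
  -- good and bad levels
  have hg := hchain T τ A t x u p n hframe hτ htypeI hL3 hA ht hexp
  have hb' : (((Finset.range n).filter fun k => ¬ GoodLevel M μ a u t x (k + 1)).card : ℝ) ≤
      C' * A ^ 3 :=
    (hbad T τ A t x u p n hframe hτ htypeI hL3 hA ht).trans
      (mul_le_mul_of_nonneg_right (le_max_left _ _) (by positivity))
  have hsplit : (((Finset.range n).filter fun k => GoodLevel M μ a u t x (k + 1)).card : ℝ) +
      (((Finset.range n).filter fun k => ¬ GoodLevel M μ a u t x (k + 1)).card : ℝ) = n := by
    have h := Finset.card_filter_add_card_filter_not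
      (s := Finset.range n) (fun k => GoodLevel M μ a u t x (k + 1))
    rw [Finset.card_range] at h
    exact_mod_cast h
  have hgood_le : (((Finset.range n).filter fun k => GoodLevel M μ a u t x (k + 1)).card : ℝ) ≤
      A ^ 3 / c := by
    rw [le_div_iff₀ hc]
    exact hg
  -- count: `n ≤ A³/c + C' A³` but `n ≥ L − 2 = A³/c + C' A³ + 2A³ − 2 ≥ A³/c + C' A³ + 14`
  have h1 : (n : ℝ) ≤ A ^ 3 / c + C' * A ^ 3 := by linarith
  have h2 : A ^ 3 / c + C' * A ^ 3 + 14 ≤ (n : ℝ) := by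
    have e : L = A ^ 3 / c + C' * A ^ 3 + 2 * A ^ 3 := by rw [hL]; ring
    linarith
  linarith

/-- **THE RUNG FROM CENSUS + CHAIN (kernel-checked): `BeadCensus → BPChainRate → R`** for every Type-I
constant `M` — large `M` by the counting above at separation `a := max a₀ a₁`, small `M` by
antitonicity. -/
theorem typeIQuantCubicExp_of_beadCensus_of_bpChainRate (hcensus : BeadCensus) (hchain : BPChainRate) :
    TypeIQuantCubicExp := by
  obtain ⟨μ, M₀, b, hμ, hM₀, hb, hlarge⟩ := hchain
  intro M
  obtain ⟨a₁, c, ha₁, hc, hch⟩ := hlarge (max M M₀) (le_max_right _ _)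
  obtain ⟨a₀, hcen⟩ := hcensus μ (max M M₀) hμ (hM₀.trans (le_max_right _ _))
  have ha : 0 < max a₀ a₁ := lt_of_lt_of_le ha₁ (le_max_right _ _)
  exact quantCubicExpAt_antitone (le_max_left M M₀)
    (quantCubicExpAt_of_censusAt_of_chainAt ha hb hc (hch _ (le_max_right _ _))
      (hcen _ (le_max_left _ _)))

/-- `FlarePersistence → BPChainRate → R` (kernel-checked). -/
theorem typeIQuantCubicExp_of_flarePersistence_of_bpChainRate (hF : FlarePersistence)
    (hchain : BPChainRate) : TypeIQuantCubicExp :=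
  typeIQuantCubicExp_of_beadCensus_of_bpChainRate (beadCensus_of_flarePersistence hF) hchain

/-- The line's board edge with the stubs plugged in (sorries = exactly the two stubs
`stub_flarePersistence`, `stub_bpChainRate`). -/
theorem typeIQuantCubicExp_of_stubs : TypeIQuantCubicExp :=
  typeIQuantCubicExp_of_flarePersistence_of_bpChainRate stub_flarePersistence stub_bpChainRate

end

end Summit.NavierStokesRegularity.NavierStokesRegularity.Cruxes.TypeIQuantSubcubicExp.BeadCensus
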